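import Literature.NumberTheory.ComplexMultiplication.KottwitzSignatureReflexFieldDegree
import HarnessLib

/-!
# The reflex field of the Kudla–Rapoport / Howard / Picard signature `((n−1, 1)_{φ₀}, (n, 0)_{φ ∈ Φ∖{φ₀}})`:
# `E = E_Φ · φ₀(F)` (`n ≥ 3`), of degree `#{(τΦ, τφ₀)}`; `= φ₀(F)` for `F/ℚ` Galois; imaginary quadratic `F`: `F` (`n ≠ 2`), `ℚ` (`n = 2`)

Layer `Literature/NumberTheory/ComplexMultiplication`, namespace `Literature.NumberTheory.ComplexMultiplication` (lane
`lit-hodgefound`, Track 2 foundations, Layer A3; seat `lit-hodgefound-p11`, generation 29, row g29-#9).  Sequel of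
`KottwitzSignatureReflexField` (g28-#4 §5: for the Rapoport–Smithling–Zhang signature `r` — `r_{φ₀} = 1`, `r = 0` on `Φ ∖ {φ₀}`,
`r_φ = n − r_φ̄` off `Φ` — `E_r = E_Φ · φ₀(F)` when `n ≥ 3`), `CMTypeDistinguishedElementReflexField` (g28-#1:
`Aut(ℂ/E_Φ·φ₀(F)) = Stab(Φ) ∩ Stab(φ₀)`), `KottwitzSignatureReflexFieldDegree` (g29-#5: `E_{n−r} = E_r`, `[E : ℚ] = #{(τΦ, τφ₀)}`)
and `KottwitzSignatureReflexFieldRationalOrCM` (g29-#1: quadratic `F`).  The signature most used in print is the DUAL one,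
`s = n − r`: `(n−1, 1)` at `φ₀` and `(n, 0)` at the other places — Kudla–Rapoport's `𝓜(n−1, 1)`, Howard's Kudla–Rapoport
divisors, and for `n = 3` the PICARD MODULAR SURFACES (`(2,1)` at one place, `(3,0)` at the others).  THIS file reads the
tree's `r`-results for `s`.  THEOREMS ONLY (D-0026): no definition, no named fact, no instance; `s` is given by its printed
clauses as hypotheses `s φ₀ = n − 1`, `s φ = n (φ ∈ Φ, φ ≠ φ₀)`, `s φ = n − s φ̄ (φ ∉ Φ)`, and `E_s = ℚ(∑_φ s_φ φ(a) ∣ a ∈ F)`.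

THE PRINTS.  S. Kudla, M. Rapoport, *Special cycles on unitary Shimura varieties II* [KudlaRapoport2013] §4.1 (held text
`paper:arxiv-0912.3758` p. 14: «a hermitian vector space `V` over `k` of signature `(n−r, r)` […] there is a Shimura variety
`Sh^V_K` over `k`», footnote «In the case where `n` is even and `r = n−r`, the reflex field is `ℚ`») and §4.4 (p. 15: «the
canonical model over the reflex field `E`, where `E = ℚ` if `r = n−r`, and `E = k` otherwise»).  M. Rapoport, B. Smithling,
W. Zhang [RapoportSmithlingZhang2017] §3.1 eq. (3.1) (`Aut(ℂ/E) = {σ ∣ σΦ = Φ, σφ₀ = φ₀}`, «`E` contains `F` via `φ₀` …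
possibly a proper extension when `F/ℚ` is not Galois»).  R. E. Kottwitz [Kottwitz1992] §5 pp. 389–390 (the reflex field `E`
of the determinant datum).  R. P. Langlands, D. Ramakrishnan (eds.), *The zeta functions of Picard modular surfaces* (1992)
and B. Dodson [Dodson1984] §3.1.1 for the `(2,1)` case over an imaginary quadratic field (reflex field `k`).

WHAT IS PROVED (`F` CM, `Φ : CMType F`, `φ₀ ∈ Φ`, `s` with the three clauses, `n ≥ 1`).
§1 `apply_add_apply_conjugate_eq_of_kr` (`s_φ + s_φ̄ = n`), `sub_apply_eq_one_of_kr` / `sub_apply_eq_zero_of_kr` /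
   `sub_apply_eq_of_kr` (`n − s` is RSZ's `r`), **`adjoin_sum_eq_adjoin_sum_sub_of_kr`** (`E_s = E_{n−s}`, g29-#5).
§2 **`adjoin_sum_eq_traceField_sup_fieldRange_of_kr`** (`n ≥ 3`: `E_s = E_Φ · φ₀(F)`),
   `adjoin_sum_sup_traceField_eq_of_kr` (any `n ≥ 1`: `E_s · E_Φ = E_Φ · φ₀(F)`), `adjoin_sum_le_traceField_sup_fieldRange_of_kr`,
   `traceField_le_adjoin_sum_of_kr`, `apply_mem_adjoin_sum_of_kr` (`φ₀(F) ⊆ E_s`), **`forall_apply_smul_eq_iff_of_kr`**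
   (`Stab(s) = Stab(Φ) ∩ Stab(φ₀)`, `n ≥ 3`), **`finrank_adjoin_sum_eq_natCard_galoisClass_datum_of_kr`** (`[E_s : ℚ] = #{(τΦ, τφ₀)}`).
§3 **`adjoin_sum_eq_fieldRange_of_kr_of_isGalois`** (`F/ℚ` Galois, `n ≥ 3`: `E_s = φ₀(F)`), `finrank_adjoin_sum_eq_of_kr_of_isGalois`;
   `F` imaginary quadratic (`[F : ℚ] = 2`): **`adjoin_sum_eq_fieldRange_of_kr_of_finrank_eq_two`** (`1 ≤ n ≠ 2`: `E_s = φ₀(F) ≅ k`,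
   Kudla–Rapoport's «`E = k` otherwise»; the Picard case `n = 3`) and **`adjoin_sum_eq_bot_of_kr_of_finrank_eq_two`** (`n = 2`:
   signature `(1,1)`, «the reflex field is `ℚ`»).

## References

* [KudlaRapoport2013] S. Kudla, M. Rapoport, *Special cycles on unitary Shimura varieties II: global theory*, J. reine angew.
  Math. 697 (2014); arXiv:0912.3758 §4.1 (with footnote), §4.4.
* [RapoportSmithlingZhang2017] M. Rapoport, B. Smithling, W. Zhang, *Arithmetic diagonal cycles on unitary Shimura varieties*,
  Compositio Math. 156 (2020); arXiv:1710.06962v3 §3.1 eq. (3.1).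
* [Kottwitz1992] R. E. Kottwitz, *Points on some Shimura varieties over finite fields*, JAMS 5 (1992), §5 pp. 389–390.
* [Dodson1984] B. Dodson, *The structure of Galois groups of CM-fields*, Trans. AMS 283 (1984), §3.1.1.
* [MilneFT2022] J. S. Milne, *Fields and Galois Theory* (2022), Cor. 3.4, Thm. 3.16.

## Provenance

Lane `lit-hodgefound` (HOME `run/shared/lean/pub/lit-hodgefound/`), prover seat `lit-hodgefound-p11` (gen 29), self-proposed row
g29-#9 (lane INBOX claim 2026-08-27), sequel of g28-#4 §5 / g28-#1 / g29-#5 / g29-#1.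
-/

set_option autoImplicit false

noncomputable section

open scoped Classical
open NumberField Module IntermediateField

namespace Literature.NumberTheory.ComplexMultiplication

open Literature.AlgebraicGeometry.Motives (CMType)
open Literature.AlgebraicGeometry.Motives.HodgeStructure (cmTypeSmul)

variable {F : Type} [Field F] {Φ : CMType F} {φ₀ : F →+* ℂ} {n : ℕ} {s : (F →+* ℂ) → ℕ}

/-! ## §1 The clauses of `s = ((n−1,1)_{φ₀}, (n,0))`; `n − s` is RSZ's `r`; `E_s = E_{n−s}` -/

section Clauses

/-- A member of `Φ` has its conjugate outside `Φ`. [folklore] -/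
private theorem conjugate_not_mem_kr {φ : F →+* ℂ} (hφ : φ ∈ Φ.1) : ComplexEmbedding.conjugate φ ∉ Φ.1 :=
  (Φ.2 φ).1 hφ

/-- A non-member of `Φ` has its conjugate inside `Φ`. [folklore] -/
private theorem conjugate_mem_kr {φ : F →+* ℂ} (hφ : φ ∉ Φ.1) : ComplexEmbedding.conjugate φ ∈ Φ.1 := by
  by_contra h
  exact hφ ((Φ.2 φ).2 h)

/-- `s ≤ n` on `Φ`. [cite: KudlaRapoport2013, §4.1 (arXiv p. 14)] -/
theorem apply_le_of_kr_of_mem (hs₀ : s φ₀ = n - 1) (hsΦ : ∀ φ : F →+* ℂ, φ ∈ Φ.1 → φ ≠ φ₀ → s φ = n)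
    {φ : F →+* ℂ} (hφ : φ ∈ Φ.1) : s φ ≤ n := by
  by_cases h : φ = φ₀
  · rw [h, hs₀]; omega
  · rw [hsΦ φ hφ h]

/-- **`s_φ + s_φ̄ = n` for every `φ`** (the signature is unitary). [cite: KudlaRapoport2013, §4.1 (arXiv p. 14)]
[cite: RapoportSmithlingZhang2017, §3.1] -/
theorem apply_add_apply_conjugate_eq_of_kr (hs₀ : s φ₀ = n - 1) (hsΦ : ∀ φ : F →+* ℂ, φ ∈ Φ.1 → φ ≠ φ₀ → s φ = n)
    (hsc : ∀ φ : F →+* ℂ, φ ∉ Φ.1 → s φ = n - s (ComplexEmbedding.conjugate φ)) (φ : F →+* ℂ) :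
    s φ + s (ComplexEmbedding.conjugate φ) = n := by
  by_cases hφ : φ ∈ Φ.1
  · have h1 := hsc _ (conjugate_not_mem_kr hφ)
    rw [show ComplexEmbedding.conjugate (ComplexEmbedding.conjugate φ) = φ from RingHom.ext fun _ => by simp] at h1
    have h2 := apply_le_of_kr_of_mem hs₀ hsΦ hφ
    omega
  · have h1 := hsc φ hφ
    have h2 := apply_le_of_kr_of_mem hs₀ hsΦ (conjugate_mem_kr hφ)
    omega

/-- `(n − s)_{φ₀} = 1` (`n ≥ 1`). [cite: RapoportSmithlingZhang2017, Introduction p. 2] -/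
theorem sub_apply_eq_one_of_kr (hn : 1 ≤ n) (hs₀ : s φ₀ = n - 1) : n - s φ₀ = 1 := by
  rw [hs₀]; omega

/-- `(n − s)_φ = 0` for `φ ∈ Φ ∖ {φ₀}`. [cite: RapoportSmithlingZhang2017, Introduction p. 2] -/
theorem sub_apply_eq_zero_of_kr (hsΦ : ∀ φ : F →+* ℂ, φ ∈ Φ.1 → φ ≠ φ₀ → s φ = n) (φ : F →+* ℂ) (hφ : φ ∈ Φ.1)
    (hne : φ ≠ φ₀) : n - s φ = 0 := by
  rw [hsΦ φ hφ hne, Nat.sub_self]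

/-- `(n − s)_φ = n − (n − s)_φ̄` off `Φ`. [cite: RapoportSmithlingZhang2017, Introduction p. 2] -/
theorem sub_apply_eq_of_kr (hs₀ : s φ₀ = n - 1) (hsΦ : ∀ φ : F →+* ℂ, φ ∈ Φ.1 → φ ≠ φ₀ → s φ = n)
    (hsc : ∀ φ : F →+* ℂ, φ ∉ Φ.1 → s φ = n - s (ComplexEmbedding.conjugate φ)) (φ : F →+* ℂ) (_hφ : φ ∉ Φ.1) :
    n - s φ = n - (n - s (ComplexEmbedding.conjugate φ)) := by
  have h := apply_add_apply_conjugate_eq_of_kr hs₀ hsΦ hsc φ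
  omega

variable [NumberField F]

/-- **`E_s = E_{n−s}`**: the Kudla–Rapoport signature and the Rapoport–Smithling–Zhang signature `n − s` have the same reflex
field (g29-#5 `adjoin_sum_sub_eq_adjoin_sum`). [cite: KudlaRapoport2013, §4.4 (arXiv p. 15)] [cite: Kottwitz1992, §5 p. 390] -/
theorem adjoin_sum_eq_adjoin_sum_sub_of_kr (hs₀ : s φ₀ = n - 1) (hsΦ : ∀ φ : F →+* ℂ, φ ∈ Φ.1 → φ ≠ φ₀ → s φ = n)
    (hsc : ∀ φ : F →+* ℂ, φ ∉ Φ.1 → s φ = n - s (ComplexEmbedding.conjugate φ)) :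
    IntermediateField.adjoin ℚ (Set.range fun a : F => ∑ φ : F →+* ℂ, (s φ : ℂ) * φ a) =
      IntermediateField.adjoin ℚ (Set.range fun a : F => ∑ φ : F →+* ℂ, ((n - s φ : ℕ) : ℂ) * φ a) :=
  (adjoin_sum_sub_eq_adjoin_sum s (apply_add_apply_conjugate_eq_of_kr hs₀ hsΦ hsc)).symm

end Clauses

/-! ## §2 `E_s = E_Φ · φ₀(F)` (`n ≥ 3`), `Stab(s) = Stab(Φ) ∩ Stab(φ₀)`, `[E_s : ℚ] = #{(τΦ, τφ₀)}` -/

section Reflex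

variable [NumberField F] [IsCMField F]

/-- **`n ≥ 3`: THE REFLEX FIELD OF THE SIGNATURE `((n−1,1)_{φ₀}, (n,0)_{φ ∈ Φ∖{φ₀}})` IS `E_Φ · φ₀(F)`** (Kudla–Rapoport /
Howard / Picard for `n = 3`; via `E_s = E_{n−s}` and the RSZ case g28-#4). [cite: RapoportSmithlingZhang2017, §3.1 eq. (3.1)]
[cite: KudlaRapoport2013, §4.1 and §4.4] [cite: Kottwitz1992, §5 pp. 389–390] -/
theorem adjoin_sum_eq_traceField_sup_fieldRange_of_kr (hφ₀ : φ₀ ∈ Φ.1) (hs₀ : s φ₀ = n - 1)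
    (hsΦ : ∀ φ : F →+* ℂ, φ ∈ Φ.1 → φ ≠ φ₀ → s φ = n)
    (hsc : ∀ φ : F →+* ℂ, φ ∉ Φ.1 → s φ = n - s (ComplexEmbedding.conjugate φ)) 
    (h3 : 3 ≤ n) :
    IntermediateField.adjoin ℚ (Set.range fun a : F => ∑ φ : F →+* ℂ, (s φ : ℂ) * φ a) =
      traceField Φ ⊔ φ₀.toRatAlgHom.fieldRange := by
  rw [adjoin_sum_eq_adjoin_sum_sub_of_kr hs₀ hsΦ hsc]
  exact adjoin_sum_eq_traceField_sup_fieldRange hφ₀ (sub_apply_eq_one_of_kr (by omega) hs₀) (sub_apply_eq_zero_of_kr hsΦ)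
    (sub_apply_eq_of_kr hs₀ hsΦ hsc) h3

/-- Any `n ≥ 1`: **`E_s · E_Φ = E_Φ · φ₀(F)`**. [cite: RapoportSmithlingZhang2017, Introduction p. 2 and §3.1 eq. (3.1)]
[cite: KudlaRapoport2013, §4.4] -/
theorem adjoin_sum_sup_traceField_eq_of_kr (hφ₀ : φ₀ ∈ Φ.1) (hs₀ : s φ₀ = n - 1)
    (hsΦ : ∀ φ : F →+* ℂ, φ ∈ Φ.1 → φ ≠ φ₀ → s φ = n)
    (hsc : ∀ φ : F →+* ℂ, φ ∉ Φ.1 → s φ = n - s (ComplexEmbedding.conjugate φ)) 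
    (hn : 1 ≤ n) :
    IntermediateField.adjoin ℚ (Set.range fun a : F => ∑ φ : F →+* ℂ, (s φ : ℂ) * φ a) ⊔ traceField Φ =
      traceField Φ ⊔ φ₀.toRatAlgHom.fieldRange := by
  rw [adjoin_sum_eq_adjoin_sum_sub_of_kr hs₀ hsΦ hsc]
  exact adjoin_sum_sup_traceField_eq_traceField_sup_fieldRange hφ₀ (sub_apply_eq_one_of_kr hn hs₀)
    (sub_apply_eq_zero_of_kr hsΦ) (sub_apply_eq_of_kr hs₀ hsΦ hsc)

/-- Any `n ≥ 1`: `E_s ⊆ E_Φ · φ₀(F)`. [cite: RapoportSmithlingZhang2017, §3.1 eq. (3.1)] -/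
theorem adjoin_sum_le_traceField_sup_fieldRange_of_kr (hφ₀ : φ₀ ∈ Φ.1) (hs₀ : s φ₀ = n - 1)
    (hsΦ : ∀ φ : F →+* ℂ, φ ∈ Φ.1 → φ ≠ φ₀ → s φ = n)
    (hsc : ∀ φ : F →+* ℂ, φ ∉ Φ.1 → s φ = n - s (ComplexEmbedding.conjugate φ)) 
    (hn : 1 ≤ n) :
    IntermediateField.adjoin ℚ (Set.range fun a : F => ∑ φ : F →+* ℂ, (s φ : ℂ) * φ a) ≤
      traceField Φ ⊔ φ₀.toRatAlgHom.fieldRange := by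
  rw [← adjoin_sum_sup_traceField_eq_of_kr hφ₀ hs₀ hsΦ hsc hn]
  exact le_sup_left

/-- `n ≥ 3`: `E_Φ ⊆ E_s`. [cite: RapoportSmithlingZhang2017, §3.1 Remark 3.1 (i)] -/
theorem traceField_le_adjoin_sum_of_kr (hφ₀ : φ₀ ∈ Φ.1) (hs₀ : s φ₀ = n - 1)
    (hsΦ : ∀ φ : F →+* ℂ, φ ∈ Φ.1 → φ ≠ φ₀ → s φ = n)
    (hsc : ∀ φ : F →+* ℂ, φ ∉ Φ.1 → s φ = n - s (ComplexEmbedding.conjugate φ)) 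
    (h3 : 3 ≤ n) :
    traceField Φ ≤ IntermediateField.adjoin ℚ (Set.range fun a : F => ∑ φ : F →+* ℂ, (s φ : ℂ) * φ a) := by
  rw [adjoin_sum_eq_traceField_sup_fieldRange_of_kr hφ₀ hs₀ hsΦ hsc h3]
  exact le_sup_left

/-- `n ≥ 3`: **`φ₀(F) ⊆ E_s`** («the Shimura variety … over `k`»: the reflex field contains `F` via `φ₀`).
[cite: KudlaRapoport2013, §4.1 (arXiv p. 14)] [cite: RapoportSmithlingZhang2017, §3.1] -/
theorem apply_mem_adjoin_sum_of_kr (hφ₀ : φ₀ ∈ Φ.1) (hs₀ : s φ₀ = n - 1)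
    (hsΦ : ∀ φ : F →+* ℂ, φ ∈ Φ.1 → φ ≠ φ₀ → s φ = n)
    (hsc : ∀ φ : F →+* ℂ, φ ∉ Φ.1 → s φ = n - s (ComplexEmbedding.conjugate φ)) 
    (h3 : 3 ≤ n) (x : F) :
    φ₀ x ∈ IntermediateField.adjoin ℚ (Set.range fun a : F => ∑ φ : F →+* ℂ, (s φ : ℂ) * φ a) := by
  rw [adjoin_sum_eq_traceField_sup_fieldRange_of_kr hφ₀ hs₀ hsΦ hsc h3]
  exact apply_mem_traceField_sup_fieldRange Φ φ₀ x

/-- **`n ≥ 3`: `Stab(s) = Stab(Φ) ∩ Stab(φ₀)`** — `τ` preserves the Kudla–Rapoport signature iff `τΦ = Φ` and `τφ₀ = φ₀`.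
[cite: RapoportSmithlingZhang2017, §3.1 eq. (3.1)] [cite: Kottwitz1992, §5 pp. 389–390] -/
theorem forall_apply_smul_eq_iff_of_kr (hφ₀ : φ₀ ∈ Φ.1) (hs₀ : s φ₀ = n - 1)
    (hsΦ : ∀ φ : F →+* ℂ, φ ∈ Φ.1 → φ ≠ φ₀ → s φ = n)
    (hsc : ∀ φ : F →+* ℂ, φ ∉ Φ.1 → s φ = n - s (ComplexEmbedding.conjugate φ)) 
    (h3 : 3 ≤ n) (τ : ℂ ≃+* ℂ) :
    (∀ φ : F →+* ℂ, s (τ • φ) = s φ) ↔ (∀ χ : F →+* ℂ, τ • χ ∈ Φ.1 ↔ χ ∈ Φ.1) ∧ τ • φ₀ = φ₀ := by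
  rw [← forall_apply_smul_eq_iff hφ₀ (sub_apply_eq_one_of_kr (by omega) hs₀) (sub_apply_eq_zero_of_kr hsΦ)
    (sub_apply_eq_of_kr hs₀ hsΦ hsc) h3 τ]
  have hle : ∀ φ : F →+* ℂ, s φ ≤ n := fun φ => by
    have := apply_add_apply_conjugate_eq_of_kr hs₀ hsΦ hsc φ; omega
  refine forall_congr' fun φ => ?_
  have h1 := hle φ
  have h2 := hle (τ • φ)
  omega

/-- `n ≥ 3`: `τ` preserves `s` iff `τ` fixes `E_Φ · φ₀(F)` pointwise. [cite: RapoportSmithlingZhang2017, §3.1 eq. (3.1)]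
[cite: MilneFT2022, Cor. 3.4] -/
theorem forall_apply_smul_eq_iff_forall_mem_of_kr (hφ₀ : φ₀ ∈ Φ.1) (hs₀ : s φ₀ = n - 1)
    (hsΦ : ∀ φ : F →+* ℂ, φ ∈ Φ.1 → φ ≠ φ₀ → s φ = n)
    (hsc : ∀ φ : F →+* ℂ, φ ∉ Φ.1 → s φ = n - s (ComplexEmbedding.conjugate φ)) 
    (h3 : 3 ≤ n) (τ : ℂ ≃+* ℂ) :
    (∀ φ : F →+* ℂ, s (τ • φ) = s φ) ↔ ∀ z : ℂ, z ∈ traceField Φ ⊔ φ₀.toRatAlgHom.fieldRange → τ z = z := by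
  rw [forall_apply_smul_eq_iff_of_kr hφ₀ hs₀ hsΦ hsc h3, forall_mem_traceField_sup_fieldRange_iff]

/-- **`n ≥ 3`: `[E_s : ℚ] = #{(τΦ, τφ₀) ∣ τ ∈ Aut(ℂ)}`** (g29-#5). [cite: Kottwitz1992, §5 pp. 389–390]
[cite: RapoportSmithlingZhang2017, §3.1 eq. (3.1)] -/
theorem finrank_adjoin_sum_eq_natCard_galoisClass_datum_of_kr (hφ₀ : φ₀ ∈ Φ.1) (hs₀ : s φ₀ = n - 1)
    (hsΦ : ∀ φ : F →+* ℂ, φ ∈ Φ.1 → φ ≠ φ₀ → s φ = n)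
    (hsc : ∀ φ : F →+* ℂ, φ ∉ Φ.1 → s φ = n - s (ComplexEmbedding.conjugate φ)) 
    (h3 : 3 ≤ n) :
    finrank ℚ (IntermediateField.adjoin ℚ (Set.range fun a : F => ∑ φ : F →+* ℂ, (s φ : ℂ) * φ a)) =
      Nat.card {p : CMType F × (F →+* ℂ) // ∃ τ : ℂ ≃+* ℂ, p = (cmTypeSmul τ Φ, τ • φ₀)} := by
  rw [adjoin_sum_eq_traceField_sup_fieldRange_of_kr hφ₀ hs₀ hsΦ hsc h3, natCard_galoisClass_datum_eq_finrank_traceField_sup_fieldRange]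

end Reflex

/-! ## §3 `F/ℚ` Galois: `E_s = φ₀(F)`; `F` imaginary quadratic: `k` (`n ≠ 2`) or `ℚ` (`n = 2`) -/

section Special

variable [NumberField F]

/-- `[φ₀(F) : ℚ] = [F : ℚ]`. [folklore] -/
private theorem finrank_fieldRange_kr (t : F →+* ℂ) : finrank ℚ t.toRatAlgHom.fieldRange = finrank ℚ F := by
  rw [← IntermediateField.finrank_eq_finrank_subalgebra, AlgHom.fieldRange_toSubalgebra]
  exact (AlgEquiv.ofInjectiveField t.toRatAlgHom).toLinearEquiv.finrank_eq.symm

variable [IsCMField F]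

/-- **`F/ℚ` GALOIS, `n ≥ 3`: `E_s = φ₀(F)`** (then `E_Φ ⊆ φ₀(F)`). [cite: RapoportSmithlingZhang2017, §3.1 (after eq. (3.1))]
[cite: KudlaRapoport2013, §4.4] -/
theorem adjoin_sum_eq_fieldRange_of_kr_of_isGalois (hφ₀ : φ₀ ∈ Φ.1) (hs₀ : s φ₀ = n - 1)
    (hsΦ : ∀ φ : F →+* ℂ, φ ∈ Φ.1 → φ ≠ φ₀ → s φ = n)
    (hsc : ∀ φ : F →+* ℂ, φ ∉ Φ.1 → s φ = n - s (ComplexEmbedding.conjugate φ)) 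
    [IsGalois ℚ F] (h3 : 3 ≤ n) :
    IntermediateField.adjoin ℚ (Set.range fun a : F => ∑ φ : F →+* ℂ, (s φ : ℂ) * φ a) = φ₀.toRatAlgHom.fieldRange := by
  rw [adjoin_sum_eq_traceField_sup_fieldRange_of_kr hφ₀ hs₀ hsΦ hsc h3, traceField_sup_fieldRange_eq_fieldRange_of_isGalois]

/-- `F/ℚ` Galois, `n ≥ 3`: `[E_s : ℚ] = [F : ℚ]`. [cite: RapoportSmithlingZhang2017, §3.1 (after eq. (3.1))] -/
theorem finrank_adjoin_sum_eq_of_kr_of_isGalois (hφ₀ : φ₀ ∈ Φ.1) (hs₀ : s φ₀ = n - 1)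
    (hsΦ : ∀ φ : F →+* ℂ, φ ∈ Φ.1 → φ ≠ φ₀ → s φ = n)
    (hsc : ∀ φ : F →+* ℂ, φ ∉ Φ.1 → s φ = n - s (ComplexEmbedding.conjugate φ)) 
    [IsGalois ℚ F] (h3 : 3 ≤ n) :
    finrank ℚ (IntermediateField.adjoin ℚ (Set.range fun a : F => ∑ φ : F →+* ℂ, (s φ : ℂ) * φ a)) = finrank ℚ F := by
  rw [adjoin_sum_eq_fieldRange_of_kr_of_isGalois hφ₀ hs₀ hsΦ hsc h3, finrank_fieldRange_kr]

/-- **`F = k` IMAGINARY QUADRATIC, `n ≠ 2`: the reflex field of `(n−1, 1)` is `φ₀(k) ≅ k`** («`E = k` otherwise»; the Picard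
case `n = 3`). [cite: KudlaRapoport2013, §4.1 with footnote and §4.4 (arXiv pp. 14–15)] [cite: Dodson1984, §3.1.1] -/
theorem adjoin_sum_eq_fieldRange_of_kr_of_finrank_eq_two (hs₀ : s φ₀ = n - 1)
    (hsΦ : ∀ φ : F →+* ℂ, φ ∈ Φ.1 → φ ≠ φ₀ → s φ = n)
    (hsc : ∀ φ : F →+* ℂ, φ ∉ Φ.1 → s φ = n - s (ComplexEmbedding.conjugate φ)) 
    (h2 : finrank ℚ F = 2) (hn1 : 1 ≤ n) (hn : n ≠ 2) :
    IntermediateField.adjoin ℚ (Set.range fun a : F => ∑ φ : F →+* ℂ, (s φ : ℂ) * φ a) = φ₀.toRatAlgHom.fieldRange := by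
  have h1 := apply_add_apply_conjugate_eq_of_kr hs₀ hsΦ hsc φ₀
  refine adjoin_sum_eq_fieldRange_of_apply_ne h2 s φ₀ fun h => hn ?_
  have h' : s φ₀ = s (ComplexEmbedding.conjugate φ₀) := h
  omega

/-- `k` imaginary quadratic, `n ≠ 2`: `[E_s : ℚ] = 2`. [cite: KudlaRapoport2013, §4.4 (arXiv p. 15)] -/
theorem finrank_adjoin_sum_eq_two_of_kr_of_finrank_eq_two (hs₀ : s φ₀ = n - 1)
    (hsΦ : ∀ φ : F →+* ℂ, φ ∈ Φ.1 → φ ≠ φ₀ → s φ = n)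
    (hsc : ∀ φ : F →+* ℂ, φ ∉ Φ.1 → s φ = n - s (ComplexEmbedding.conjugate φ)) 
    (h2 : finrank ℚ F = 2) (hn1 : 1 ≤ n) (hn : n ≠ 2) :
    finrank ℚ (IntermediateField.adjoin ℚ (Set.range fun a : F => ∑ φ : F →+* ℂ, (s φ : ℂ) * φ a)) = 2 := by
  rw [adjoin_sum_eq_fieldRange_of_kr_of_finrank_eq_two hs₀ hsΦ hsc h2 hn1 hn, finrank_fieldRange_kr, h2]

/-- **`k` IMAGINARY QUADRATIC, `n = 2`: signature `(1,1)`, the reflex field is `ℚ`** («In the case where `n` is even and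
`r = n − r`, the reflex field is `ℚ`»). [cite: KudlaRapoport2013, §4.1 footnote (arXiv p. 14)] -/
theorem adjoin_sum_eq_bot_of_kr_of_finrank_eq_two (hs₀ : s φ₀ = n - 1)
    (hsΦ : ∀ φ : F →+* ℂ, φ ∈ Φ.1 → φ ≠ φ₀ → s φ = n)
    (hsc : ∀ φ : F →+* ℂ, φ ∉ Φ.1 → s φ = n - s (ComplexEmbedding.conjugate φ)) 
    (h2 : finrank ℚ F = 2) (hn : n = 2) :
    IntermediateField.adjoin ℚ (Set.range fun a : F => ∑ φ : F →+* ℂ, (s φ : ℂ) * φ a) = ⊥ := by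
  have h1 := apply_add_apply_conjugate_eq_of_kr hs₀ hsΦ hsc φ₀
  refine (adjoin_sum_eq_bot_iff_apply_eq_of_finrank_eq_two h2 s φ₀).2 ?_
  omega

end Special

end Literature.NumberTheory.ComplexMultiplication
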